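import Summits.CriticalPhenomena.PercolationContinuityZ3.Theorems.PercNearOneGluingAdditiveGluingBlockKernelGoodNeighbour
import HarnessLib

/-! # Crux `PercNearOneGluing.AdditiveGluing` (stmt-CriticalPhenomena-4576), residual kernel — closing a residual instance by ONE pair
# (invested seat xfam-a)

Support file (`--supports stmt-CriticalPhenomena-4576`; no definitions, no named facts) packaging the corner-expansion tools of
`…BlockKernelMix.lean` / `…BlockKernelGoodNeighbour.lean` with the induction hypothesis of `stub_goodStep` in the form it has inside the
residual kernel `hresIH` of `goodStep_of_residualKernelIH` (`…GoodStepResidualIH.lean`): goodness of every weighting with at most as many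
positive-degree vertices as the glued block graph `u/S`.

* `card_posdeg_glue_update_le`: contracting a pair of positive weight or deleting any pair, then gluing `S`, does not increase the number of
  positive-degree vertices — so the IH of `hresIH` applies to both corner weightings of every positive pair.
* `blockKernel_pocketFree` (leaf T0): the block kernel holds as soon as `μ_{u/S}(a₀ ↔ b) ≤ μ_u(S ↔ b)` (pockets are non-negative).
* `blockKernel_pair_L5_ih` : expand a positive pair `e = s(x, y)`, `x ∈ S`: the contracted corner by KN Lemma 5 through `x ≡ y` (`y` at least
  as reliable as `a₀` there), the deleted corner by the IH leaf (`a₀` a minimiser of the glued two-point function of `u[e↦0]/S`).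
* `blockKernel_pair_ih_ih` : expand any positive pair `e ⊄ S`... both corners drift-free: both by the IH leaf.
[cite: KozmaNitzan2024, §3.2 (Lemma 5 p. 13, Thms 4–5 pp. 12–14), §5.3 p. 34]
-/

namespace Summit.CriticalPhenomena.PercolationContinuityZ3.Theorems

open MeasureTheory Set
open Literature.Probability.LatticeModels (prodBernoulli)
open Literature.Probability.Percolation (BondConfig openConn openConnIn openGraph openCluster)
open scoped BigOperators

noncomputable section
open Classical

section PairClosure

open Literature.Probability.LatticeModels Literature.Probability.Percolation

variable {n : ℕ}

/-- **Corner weightings are not bigger.**  For a pair `e` and a value `c` with `c = 0` or `u e ≠ 0`, the glued weighting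
`(u[e ↦ c])/S` has at most as many positive-degree vertices as `u/S`. [folklore] -/
theorem card_posdeg_glue_update_le (u : Sym2 (Fin n) → unitInterval) (S : Finset (Fin n)) (e : Sym2 (Fin n))
    (c : unitInterval) (hc : c = 0 ∨ (u e : ℝ) ≠ 0) :
    (Finset.univ.filter (fun v : Fin n => ∃ x : Fin n,
        0 < ((fun e' : Sym2 (Fin n) => if (∀ z ∈ e', z ∈ S) ∧ ¬ e'.IsDiag then 1 else Function.update u e c e') s(x, v) : ℝ))).card ≤
      (Finset.univ.filter (fun v : Fin n => ∃ x : Fin n,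
        0 < ((fun e' : Sym2 (Fin n) => if (∀ z ∈ e', z ∈ S) ∧ ¬ e'.IsDiag then 1 else u e') s(x, v) : ℝ))).card := by
  refine Finset.card_le_card fun v hv => ?_
  simp only [Finset.mem_filter, Finset.mem_univ, true_and] at hv ⊢
  obtain ⟨x, hx⟩ := hv
  refine ⟨x, ?_⟩
  by_cases hS : (∀ z ∈ s(x, v), z ∈ S) ∧ ¬ (s(x, v)).IsDiag
  · rw [if_pos hS] at hx ⊢
    exact hx
  · rw [if_neg hS] at hx ⊢
    by_cases hxe : s(x, v) = e
    · rw [hxe, Function.update_self] at hx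
      rw [hxe]
      rcases hc with rfl | hne
      · simp at hx
      · exact lt_of_le_of_ne (unitInterval.nonneg _) (Ne.symm hne)
    · rwa [Function.update_of_ne hxe] at hx

/-- **Leaf T0 (pocket-free).**  If the designated relay is at most as reliable in the GLUED graph as the block is in the un-glued one,
`μ_{u/S}(a₀ ↔ b) ≤ μ_u(S ↔ b)`, the block kernel holds (its pocket sum is non-negative). [cite: KozmaNitzan2024, §3.2 (Definition p. 12)] -/
theorem blockKernel_pocketFree (u : Sym2 (Fin n) → unitInterval) (A S : Finset (Fin n)) (b a₀ : Fin n)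
    (sel : Finset (Fin n) → Fin n)
    (hT0 : (prodBernoulli (fun e : Sym2 (Fin n) => if (∀ x ∈ e, x ∈ S) ∧ ¬ e.IsDiag then 1 else u e)).real (openConn a₀ b) ≤
      (prodBernoulli u).real (⋃ s ∈ S, openConn s b)) :
    (prodBernoulli u).real (openConn a₀ b)
        + (prodBernoulli u).real ((openConn a₀ b)ᶜ ∩ (⋃ s ∈ S, openConn a₀ s) ∩ (⋃ s ∈ S, openConn s b))
      ≤ (prodBernoulli u).real (⋃ s ∈ S, openConn s b)
        + ∑ W ∈ (Finset.univ : Finset (Finset (Fin n))).filter (fun W => Disjoint W A),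
            (prodBernoulli u).real {ω : BondConfig (Fin n) | ∀ z : Fin n, (z ∈ W ↔ ω ∈ ⋃ s ∈ S, openConn s z)}
              * (prodBernoulli u).real (openConnIn ((W : Set (Fin n))ᶜ) (sel W) b) := by
  rw [blockGrowth_glue_real_openConn] at hT0
  exact hT0.trans (le_add_of_nonneg_right (Finset.sum_nonneg fun _ _ =>
    mul_nonneg measureReal_nonneg measureReal_nonneg))

/-- **Close a residual instance by one pair: contracted corner by Lemma 5, deleted corner by the induction hypothesis.**
`IH` is the hypothesis available inside `hresIH` (goodness of every weighting with at most as many positive-degree vertices as `u/S`).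
Expand the positive pair `e = s(x, y)` with `x ∈ S`: at `u[e ↦ 1]` the vertex `y` is assumed at least as reliable as `a₀` (then `x ≡ y`
and KN Lemma 5 closes the corner), at `u[e ↦ 0]` the relay `a₀` is assumed to minimise the glued two-point function (then the IH leaf
closes it). [cite: KozmaNitzan2024, §3.2 (Lemma 5 p. 13, Thm 5 pp. 13–14)] -/
theorem blockKernel_pair_L5_ih (u : Sym2 (Fin n) → unitInterval) (A S : Finset (Fin n)) (b a₀ x y s₀ : Fin n)
    (sel : Finset (Fin n) → Fin n) (hx : x ∈ S) (hs₀ : s₀ ∈ S) (hbS : b ∉ S) (hbA : b ∈ A) (hSA : Disjoint S A) (hxy : x ≠ y)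
    (hsel : ∀ W, sel W ∈ A)
    (IH : ∀ w' : Sym2 (Fin n) → unitInterval,
      (Finset.univ.filter (fun v : Fin n => ∃ z : Fin n, 0 < (w' s(z, v) : ℝ))).card ≤
        (Finset.univ.filter (fun v : Fin n => ∃ z : Fin n,
          0 < ((fun e : Sym2 (Fin n) => if (∀ x ∈ e, x ∈ S) ∧ ¬ e.IsDiag then 1 else u e) s(z, v) : ℝ))).card →
      ∀ (A' : Finset (Fin n)) (o' b' : Fin n), b' ∈ A' → o' ∉ A' →
      ∀ (t : ℝ) (sel' : Finset (Fin n) → Fin n), (∀ W, sel' W ∈ A') →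
        (∀ a ∈ A', 1 - t ≤ (prodBernoulli w').real (openConn a b')) →
        (prodBernoulli w').real ((⋃ a ∈ A', openConn o' a) ∩ (openConn o' b')ᶜ)
          + ∑ W ∈ (Finset.univ : Finset (Finset (Fin n))).filter (fun W => o' ∈ W ∧ Disjoint W A'),
              (prodBernoulli w').real {ω : BondConfig (Fin n) | openCluster ω o' = (W : Set (Fin n))}
                * (prodBernoulli w').real (openConnIn ((W : Set (Fin n))ᶜ) (sel' W) b')ᶜ
          ≤ t)
    (hgood : (prodBernoulli (Function.update u s(x, y) 1)).real (openConn a₀ b) ≤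
      (prodBernoulli (Function.update u s(x, y) 1)).real (openConn y b))
    (hmin0 : ∀ a ∈ A, (prodBernoulli (fun e : Sym2 (Fin n) =>
        if (∀ z ∈ e, z ∈ S) ∧ ¬ e.IsDiag then 1 else Function.update u s(x, y) 0 e)).real (openConn a₀ b) ≤
      (prodBernoulli (fun e : Sym2 (Fin n) =>
        if (∀ z ∈ e, z ∈ S) ∧ ¬ e.IsDiag then 1 else Function.update u s(x, y) 0 e)).real (openConn a b)) :
    (prodBernoulli u).real (openConn a₀ b)
        + (prodBernoulli u).real ((openConn a₀ b)ᶜ ∩ (⋃ s ∈ S, openConn a₀ s) ∩ (⋃ s ∈ S, openConn s b))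
      ≤ (prodBernoulli u).real (⋃ s ∈ S, openConn s b)
        + ∑ W ∈ (Finset.univ : Finset (Finset (Fin n))).filter (fun W => Disjoint W A),
            (prodBernoulli u).real {ω : BondConfig (Fin n) | ∀ z : Fin n, (z ∈ W ↔ ω ∈ ⋃ s ∈ S, openConn s z)}
              * (prodBernoulli u).real (openConnIn ((W : Set (Fin n))ᶜ) (sel W) b) := by
  have hs₀A : s₀ ∉ A := Finset.disjoint_left.1 hSA hs₀
  refine blockKernel_of_goodNeighbour u A S b a₀ x y sel hx hbS hxy hgood ?_
  refine blockGood_leaf_ih (Function.update u s(x, y) 0) A S b a₀ s₀ sel hs₀ hbA hsel hmin0 ?_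
  intro t sel' hsel' ht
  exact IH _ (card_posdeg_glue_update_le u S s(x, y) 0 (Or.inl rfl)) A s₀ b hbA hs₀A t sel' hsel' ht

/-- **Close a residual instance by one pair: both corners by the induction hypothesis.**  Expand a pair `e` of positive `u`-weight:
if at both corner weightings `u[e ↦ 1]`, `u[e ↦ 0]` the designated relay `a₀` minimises the glued two-point function over `A`, the
block kernel holds (both corners are IH leaves). [cite: KozmaNitzan2024, §3.2 (Thm 5 pp. 13–14)] -/
theorem blockKernel_pair_ih_ih (u : Sym2 (Fin n) → unitInterval) (A S : Finset (Fin n)) (b a₀ s₀ : Fin n)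
    (sel : Finset (Fin n) → Fin n) (e : Sym2 (Fin n)) (hs₀ : s₀ ∈ S) (hbA : b ∈ A) (hSA : Disjoint S A)
    (he : (u e : ℝ) ≠ 0) (hsel : ∀ W, sel W ∈ A)
    (IH : ∀ w' : Sym2 (Fin n) → unitInterval,
      (Finset.univ.filter (fun v : Fin n => ∃ z : Fin n, 0 < (w' s(z, v) : ℝ))).card ≤
        (Finset.univ.filter (fun v : Fin n => ∃ z : Fin n,
          0 < ((fun e : Sym2 (Fin n) => if (∀ x ∈ e, x ∈ S) ∧ ¬ e.IsDiag then 1 else u e) s(z, v) : ℝ))).card →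
      ∀ (A' : Finset (Fin n)) (o' b' : Fin n), b' ∈ A' → o' ∉ A' →
      ∀ (t : ℝ) (sel' : Finset (Fin n) → Fin n), (∀ W, sel' W ∈ A') →
        (∀ a ∈ A', 1 - t ≤ (prodBernoulli w').real (openConn a b')) →
        (prodBernoulli w').real ((⋃ a ∈ A', openConn o' a) ∩ (openConn o' b')ᶜ)
          + ∑ W ∈ (Finset.univ : Finset (Finset (Fin n))).filter (fun W => o' ∈ W ∧ Disjoint W A'),
              (prodBernoulli w').real {ω : BondConfig (Fin n) | openCluster ω o' = (W : Set (Fin n))}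
                * (prodBernoulli w').real (openConnIn ((W : Set (Fin n))ᶜ) (sel' W) b')ᶜ
          ≤ t)
    (hmin1 : ∀ a ∈ A, (prodBernoulli (fun e' : Sym2 (Fin n) =>
        if (∀ z ∈ e', z ∈ S) ∧ ¬ e'.IsDiag then 1 else Function.update u e 1 e')).real (openConn a₀ b) ≤
      (prodBernoulli (fun e' : Sym2 (Fin n) =>
        if (∀ z ∈ e', z ∈ S) ∧ ¬ e'.IsDiag then 1 else Function.update u e 1 e')).real (openConn a b))
    (hmin0 : ∀ a ∈ A, (prodBernoulli (fun e' : Sym2 (Fin n) =>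
        if (∀ z ∈ e', z ∈ S) ∧ ¬ e'.IsDiag then 1 else Function.update u e 0 e')).real (openConn a₀ b) ≤
      (prodBernoulli (fun e' : Sym2 (Fin n) =>
        if (∀ z ∈ e', z ∈ S) ∧ ¬ e'.IsDiag then 1 else Function.update u e 0 e')).real (openConn a b)) :
    (prodBernoulli u).real (openConn a₀ b)
        + (prodBernoulli u).real ((openConn a₀ b)ᶜ ∩ (⋃ s ∈ S, openConn a₀ s) ∩ (⋃ s ∈ S, openConn s b))
      ≤ (prodBernoulli u).real (⋃ s ∈ S, openConn s b)
        + ∑ W ∈ (Finset.univ : Finset (Finset (Fin n))).filter (fun W => Disjoint W A),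
            (prodBernoulli u).real {ω : BondConfig (Fin n) | ∀ z : Fin n, (z ∈ W ↔ ω ∈ ⋃ s ∈ S, openConn s z)}
              * (prodBernoulli u).real (openConnIn ((W : Set (Fin n))ᶜ) (sel W) b) := by
  have hs₀A : s₀ ∉ A := Finset.disjoint_left.1 hSA hs₀
  refine blockKernel_of_update u A S b a₀ sel e ⟨s₀, hs₀⟩ ?_ ?_
  · refine blockGood_leaf_ih (Function.update u e 1) A S b a₀ s₀ sel hs₀ hbA hsel hmin1 ?_
    intro t sel' hsel' ht
    exact IH _ (card_posdeg_glue_update_le u S e 1 (Or.inr he)) A s₀ b hbA hs₀A t sel' hsel' ht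
  · refine blockGood_leaf_ih (Function.update u e 0) A S b a₀ s₀ sel hs₀ hbA hsel hmin0 ?_
    intro t sel' hsel' ht
    exact IH _ (card_posdeg_glue_update_le u S e 0 (Or.inl rfl)) A s₀ b hbA hs₀A t sel' hsel' ht

end PairClosure

open Filter Literature.Probability.LatticeModels Literature.Probability.Percolation in
/-- Registered helper stub `stub_blockKernelPairL5IH_xfa` (invested seat xfam-a) = `blockKernel_pair_L5_ih`. [cite: KozmaNitzan2024, §3.2 (pp. 12–14)] -/
theorem stub_blockKernelPairL5IH_xfa : ∀ (n : ℕ) (u : Sym2 (Fin n) → unitInterval) (A S : Finset (Fin n)) (b a₀ x y s₀ : Fin n) (sel : Finset (Fin n) → Fin n), (x ∈ S) → (s₀ ∈ S) → (b ∉ S) → (b ∈ A) → (Disjoint S A) → (x ≠ y) → (∀ W, sel W ∈ A) → (∀ w' : Sym2 (Fin n) → unitInterval, (Finset.univ.filter (fun v : Fin n => ∃ z : Fin n, 0 < (w' s(z, v) : ℝ))).card ≤ (Finset.univ.filter (fun v : Fin n => ∃ z : Fin n, 0 < ((fun e : Sym2 (Fin n) => if (∀ x ∈ e, x ∈ S)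 ∧ ¬ e.IsDiag then 1 else u e) s(z, v) : ℝ))).card → ∀ (A' : Finset (Fin n)) (o' b' : Fin n), b' ∈ A' → o' ∉ A' → ∀ (t : ℝ) (sel' : Finset (Fin n) → Fin n), (∀ W, sel' W ∈ A') → (∀ a ∈ A', 1 - t ≤ (prodBernoulli w').real (openConn a b')) → (prodBernoulli w').real ((⋃ a ∈ A', openConn o' a) ∩ (openConn o' b')ᶜ) + ∑ W ∈ (Finset.univ : Finset (Finset (Fin n))).filter (fun W => o' ∈ W ∧ Disjoint W A'), (prodBernoulli w').real {ω : BondConfig (Fin n) | openCluster ω o' = (W : Set (Fin n))} * (prodBernoulli w').real (openConnIn ((W : Set (Fin n))ᶜ) (sel' W) b')ᶜ ≤ t) → ((prodBernoulli (Function.update u s(x, y) 1)).real (openConn a₀ b) ≤ (prodBernoulli (Function.update u s(x, y) 1)).real (openConn y b)) → (∀ a ∈ A, (prodBernoulli (fun e : Sym2 (Fin n) => if (∀ z ∈ e, z ∈ S) ∧ ¬ e.IsDiag then 1 else Function.update u s(x, y) 0 e)).real (openConn a₀ b) ≤ (prodBernoulli (fun e : Sym2 (Fin n) => if (∀ z ∈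 e, z ∈ S) ∧ ¬ e.IsDiag then 1 else Function.update u s(x, y) 0 e)).real (openConn a b)) → (prodBernoulli u).real (openConn a₀ b) + (prodBernoulli u).real ((openConn a₀ b)ᶜ ∩ (⋃ s ∈ S, openConn a₀ s) ∩ (⋃ s ∈ S, openConn s b)) ≤ (prodBernoulli u).real (⋃ s ∈ S, openConn s b) + ∑ W ∈ (Finset.univ : Finset (Finset (Fin n))).filter (fun W => Disjoint W A), (prodBernoulli u).real {ω : BondConfig (Fin n) | ∀ z : Fin n, (z ∈ W ↔ ω ∈ ⋃ s ∈ S, openConn s z)} * (prodBernoulli u).real (openConnIn ((W : Set (Fin n))ᶜ) (sel W) b) :=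
  fun _ u A S b a₀ x y s₀ sel hx hs₀ hbS hbA hSA hxy hsel IH hgood hmin0 => blockKernel_pair_L5_ih u A S b a₀ x y s₀ sel hx hs₀ hbS hbA hSA hxy hsel IH hgood hmin0

open Filter Literature.Probability.LatticeModels Literature.Probability.Percolation in
/-- Registered helper stub `stub_blockKernelPairIHIH_xfa` (invested seat xfam-a) = `blockKernel_pair_ih_ih`. [cite: KozmaNitzan2024, §3.2 (pp. 12–14)] -/
theorem stub_blockKernelPairIHIH_xfa : ∀ (n : ℕ) (u : Sym2 (Fin n) → unitInterval) (A S : Finset (Fin n)) (b a₀ s₀ : Fin n) (sel : Finset (Fin n) → Fin n) (e : Sym2 (Fin n)), (s₀ ∈ S) → (b ∈ A) → (Disjoint S A) → ((u e : ℝ) ≠ 0) → (∀ W, sel W ∈ A) → (∀ w' : Sym2 (Fin n) → unitInterval, (Finset.univ.filter (fun v : Fin n => ∃ z : Fin n, 0 < (w' s(z, v) : ℝ))).card ≤ (Finset.univ.filter (fun v : Fin n => ∃ z : Fin n, 0 < ((fun e : Sym2 (Fin n) => if (∀ x ∈ e, x ∈ S) ∧ ¬ e.IsDiag then 1 else u e)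 s(z, v) : ℝ))).card → ∀ (A' : Finset (Fin n)) (o' b' : Fin n), b' ∈ A' → o' ∉ A' → ∀ (t : ℝ) (sel' : Finset (Fin n) → Fin n), (∀ W, sel' W ∈ A') → (∀ a ∈ A', 1 - t ≤ (prodBernoulli w').real (openConn a b')) → (prodBernoulli w').real ((⋃ a ∈ A', openConn o' a) ∩ (openConn o' b')ᶜ) + ∑ W ∈ (Finset.univ : Finset (Finset (Fin n))).filter (fun W => o' ∈ W ∧ Disjoint W A'), (prodBernoulli w').real {ω : BondConfig (Fin n) | openCluster ω o' = (W : Set (Fin n))} * (prodBernoulli w').real (openConnIn ((W : Set (Fin n))ᶜ) (sel' W) b')ᶜ ≤ t) → (∀ a ∈ A, (prodBernoulli (fun e' : Sym2 (Fin n) => if (∀ z ∈ e', z ∈ S) ∧ ¬ e'.IsDiag then 1 else Function.update u e 1 e')).real (openConn a₀ b) ≤ (prodBernoulli (fun e' : Sym2 (Fin n) => if (∀ z ∈ e', z ∈ S) ∧ ¬ e'.IsDiag then 1 else Function.update u e 1 e')).real (openConn a b)) → (∀ a ∈ A, (prodBernoulli (fun e' : Sym2 (Fin n) => if (∀ z ∈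 e', z ∈ S) ∧ ¬ e'.IsDiag then 1 else Function.update u e 0 e')).real (openConn a₀ b) ≤ (prodBernoulli (fun e' : Sym2 (Fin n) => if (∀ z ∈ e', z ∈ S) ∧ ¬ e'.IsDiag then 1 else Function.update u e 0 e')).real (openConn a b)) → (prodBernoulli u).real (openConn a₀ b) + (prodBernoulli u).real ((openConn a₀ b)ᶜ ∩ (⋃ s ∈ S, openConn a₀ s) ∩ (⋃ s ∈ S, openConn s b)) ≤ (prodBernoulli u).real (⋃ s ∈ S, openConn s b) + ∑ W ∈ (Finset.univ : Finset (Finset (Fin n))).filter (fun W => Disjoint W A), (prodBernoulli u).real {ω : BondConfig (Fin n) | ∀ z : Fin n, (z ∈ W ↔ ω ∈ ⋃ s ∈ S, openConn s z)} * (prodBernoulli u).real (openConnIn ((W : Set (Fin n))ᶜ) (sel W) b) :=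
  fun _ u A S b a₀ s₀ sel e hs₀ hbA hSA he hsel IH hmin1 hmin0 => blockKernel_pair_ih_ih u A S b a₀ s₀ sel e hs₀ hbA hSA he hsel IH hmin1 hmin0

end

end Summit.CriticalPhenomena.PercolationContinuityZ3.Theorems
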